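import Literature.MathematicalPhysics.QuantumLattice.TwoSpeciesSectorForms
import Literature.MathematicalPhysics.QuantumLattice.HubbardSzSectorLadder
import HarnessLib

/-!
# Two-species sector coordinates: the ACTION of `H`, `c_{xσ}`, `c†_{xσ}` on coordinate arrays

Trunk T-QLATTICE, family `hubbard`; continues `TwoSpeciesCoordinates.lean` (Lieb's coefficient matrix
`W_{αβ} = σ(α,β) ψ(α↑ ∪ β↓)` on the whole Fock space and the transfer rules of the elementary
operators) and `TwoSpeciesSectorForms.lean` (enumerations `IsSubsetEnum`, the trial vectors
`ofSectorArray sa sb w`, the FORMS `⟨ψ, ψ⟩`, `⟨ψ, Hψ⟩` in a sector). Certified finite-cluster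
computations that move BETWEEN sectors (matrix elements of `c`, `c†`, resolvent residuals
`‖Hψ − ρψ‖`) need the operators at the level of VECTORS, i.e. as maps of coordinate arrays. For
enumerations `sa` of the `a`-subsets and `sb` of the `b`-subsets of the finite site set `Λ`:

* `IsInSector.eq_of_coeffMatrix_eq`, `IsInSector.eq_ofSectorArray` — a vector of the sector `(a, b)`
  is determined by (is `ofSectorArray` of) its coordinates at the enumerated subsets;
  `ofSectorArray` is linear (`ofSectorArray_add/_smul/_sum/_zero`) and
  `⟨ofSectorArray w, ofSectorArray w'⟩ = Σ conj w_{ij} w'_{ij}` (`star_ofSectorArray_dotProduct`);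
* `hamiltonian_mulVec_ofSectorArray` — Lieb's eq. (4) as an action on arrays,
  `H (ofSectorArray w) = ofSectorArray (Ka w + w Kbᵀ + U d ∘ w)` for integer tables `Ka`, `Kb`, `d`
  matching the hopping entries between the enumerated subsets and the double occupancies
  (`coeffMatrix_hamiltonian_mulVec_enum` is the entrywise form);
* `annihilation_up_mulVec_ofSectorArray`, `creation_up_mulVec_ofSectorArray`,
  `annihilation_down_mulVec_ofSectorArray`, `creation_down_mulVec_ofSectorArray` — the four
  elementary fermion operators as maps of arrays between neighbouring sectors, with the integer
  Jordan–Wigner entries `annInt` and the up-parity sign `(-1)^a` for the down species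
  (Tasaki's Jordan–Wigner string through the up orbitals).

All statements are entrywise consequences of the transfer rules of `TwoSpeciesCoordinates`
(`coeffMatrix_hamiltonian_mulVec`, `coeffMatrix_annihilation_up_mulVec`, …); nothing there is
re-proved, no definition and no named fact is introduced.

Sources: E. H. Lieb, *Two theorems on the Hubbard model*, PRL **62** (1989) 1201, proof of
Theorem 1, eqs. (3)–(4); H. Tasaki, *Physics and Mathematics of Quantum Many-Body Systems* (2020)
§9.2.1 (Jordan–Wigner signs of the two species).
-/

noncomputable section

namespace Literature.MathematicalPhysics.QuantumLattice

open Matrix Finset LiebThm1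

namespace TwoSpecies

variable {Λ : Type*} [LinearOrder Λ] [Fintype Λ]
variable {a b p q : ℕ} {sa : Fin p → Finset Λ} {sb : Fin q → Finset Λ}

/-! ### A sector vector is determined by its coordinates -/

/-- Two vectors of the sector `(a, b)` with the same coordinates at the enumerated subsets are
equal. Lieb, PRL 62 (1989) 1201, proof of Theorem 1. [cite: LiebPRL1989, proof of Theorem 1] -/
theorem IsInSector.eq_of_coeffMatrix_eq (ha : IsSubsetEnum a sa) (hb : IsSubsetEnum b sb)
    {ψ φ : Fock (Orb Λ)} (hψ : IsInSector a b ψ) (hφ : IsInSector a b φ)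
    (h : ∀ i j, coeffMatrix ψ (sa i) (sb j) = coeffMatrix φ (sa i) (sb j)) : ψ = φ := by
  refine coeffMatrix_injective (Matrix.ext fun α β => ?_)
  rw [isInSector_iff_coeffMatrix] at hψ hφ
  by_cases hαβ : α.card = a ∧ β.card = b
  · -- `α = sa i`, `β = sb j` for some enumerated indices
    have hα : α ∈ (univ : Finset (Fin p)).image sa := by
      rw [ha.image_eq, mem_filter]; exact ⟨mem_univ _, hαβ.1⟩
    have hβ : β ∈ (univ : Finset (Fin q)).image sb := by
      rw [hb.image_eq, mem_filter]; exact ⟨mem_univ _, hαβ.2⟩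
    obtain ⟨i, -, rfl⟩ := mem_image.1 hα
    obtain ⟨j, -, rfl⟩ := mem_image.1 hβ
    exact h i j
  · rw [hψ α β hαβ, hφ α β hαβ]

/-- **A sector vector is `ofSectorArray` of its coordinates.** Lieb, PRL 62 (1989) 1201, proof of
Theorem 1 (`ψ = Σ W_{αβ} ψ^α_↑ ⊗ ψ^β_↓`). [cite: LiebPRL1989, proof of Theorem 1] -/
theorem IsInSector.eq_ofSectorArray (ha : IsSubsetEnum a sa) (hb : IsSubsetEnum b sb)
    {ψ : Fock (Orb Λ)} (hψ : IsInSector a b ψ) :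
    ψ = ofSectorArray sa sb (fun i j => coeffMatrix ψ (sa i) (sb j)) :=
  IsInSector.eq_of_coeffMatrix_eq ha hb hψ (isInSector_ofSectorArray ha hb _)
    fun i j => (coeffMatrix_ofSectorArray ha hb (fun i j => coeffMatrix ψ (sa i) (sb j)) i j).symm

/-! ### Linearity of `ofSectorArray` and inner products -/

omit [Fintype Λ] in
/-- Unfolding of `ofSectorArray` at a configuration. [folklore] -/
theorem ofSectorArray_apply [Fintype Λ] (sa : Fin p → Finset Λ) (sb : Fin q → Finset Λ)
    (w : Fin p → Fin q → ℂ) (s : Finset (Orb Λ)) :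
    ofSectorArray sa sb w s = pairSign (upPart s) (downPart s) *
      ∑ i, ∑ j, if sa i = upPart s ∧ sb j = downPart s then w i j else 0 := rfl

/-- `ofSectorArray` is additive. [folklore] -/
theorem ofSectorArray_add (sa : Fin p → Finset Λ) (sb : Fin q → Finset Λ) (w w' : Fin p → Fin q → ℂ) :
    ofSectorArray sa sb (w + w') = ofSectorArray sa sb w + ofSectorArray sa sb w' := by
  funext s
  simp only [Pi.add_apply, ofSectorArray_apply, ← mul_add, ← Finset.sum_add_distrib]
  congr 1
  refine Finset.sum_congr rfl fun i _ => Finset.sum_congr rfl fun j _ => ?_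
  split_ifs <;> simp

/-- `ofSectorArray` is homogeneous. [folklore] -/
theorem ofSectorArray_smul (sa : Fin p → Finset Λ) (sb : Fin q → Finset Λ) (c : ℂ) (w : Fin p → Fin q → ℂ) :
    ofSectorArray sa sb (c • w) = c • ofSectorArray sa sb w := by
  funext s
  simp only [Pi.smul_apply, ofSectorArray_apply, smul_eq_mul, Finset.mul_sum]
  refine Finset.sum_congr rfl fun i _ => Finset.sum_congr rfl fun j _ => ?_
  split_ifs <;> ring

/-- `ofSectorArray 0 = 0`. [folklore] -/
theorem ofSectorArray_zero (sa : Fin p → Finset Λ) (sb : Fin q → Finset Λ) :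
    ofSectorArray sa sb (0 : Fin p → Fin q → ℂ) = 0 := by
  funext s
  simp [ofSectorArray_apply]

/-- `ofSectorArray` of a finite sum of arrays. [folklore] -/
theorem ofSectorArray_sum {ι : Type*} (S : Finset ι) (sa : Fin p → Finset Λ) (sb : Fin q → Finset Λ)
    (w : ι → Fin p → Fin q → ℂ) :
    ofSectorArray sa sb (∑ k ∈ S, w k) = ∑ k ∈ S, ofSectorArray sa sb (w k) := by
  classical
  induction S using Finset.induction_on with
  | empty => rw [Finset.sum_empty, Finset.sum_empty, ofSectorArray_zero]
  | insert k S hk ih => rw [Finset.sum_insert hk, Finset.sum_insert hk, ofSectorArray_add, ih]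

/-- `ofSectorArray` of a difference. [folklore] -/
theorem ofSectorArray_sub (sa : Fin p → Finset Λ) (sb : Fin q → Finset Λ) (w w' : Fin p → Fin q → ℂ) :
    ofSectorArray sa sb (w - w') = ofSectorArray sa sb w - ofSectorArray sa sb w' := by
  rw [sub_eq_add_neg, ofSectorArray_add, show -w' = (-1 : ℂ) • w' by simp, ofSectorArray_smul]
  simp [sub_eq_add_neg]

/-- **Inner product of two array vectors**: `⟨ofSectorArray w, ofSectorArray w'⟩ = Σ conj w_{ij} w'_{ij}`.
Lieb, PRL 62 (1989) 1201, proof of Theorem 1 (unitarity of `W`). [cite: LiebPRL1989, proof of Theorem 1] -/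
theorem star_ofSectorArray_dotProduct (ha : IsSubsetEnum a sa) (hb : IsSubsetEnum b sb)
    (w w' : Fin p → Fin q → ℂ) :
    star (ofSectorArray sa sb w) ⬝ᵥ ofSectorArray sa sb w' = ∑ i, ∑ j, star (w i j) * w' i j := by
  rw [sector_star_dotProduct ha hb (isInSector_ofSectorArray ha hb w)]
  simp only [coeffMatrix_ofSectorArray ha hb]

/-- The inner product of an array vector with an arbitrary vector reads off the coordinates of the
latter. [folklore] -/
theorem star_ofSectorArray_dotProduct' (ha : IsSubsetEnum a sa) (hb : IsSubsetEnum b sb)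
    (w : Fin p → Fin q → ℂ) (φ : Fock (Orb Λ)) :
    star (ofSectorArray sa sb w) ⬝ᵥ φ = ∑ i, ∑ j, star (w i j) * coeffMatrix φ (sa i) (sb j) := by
  rw [sector_star_dotProduct ha hb (isInSector_ofSectorArray ha hb w)]
  simp only [coeffMatrix_ofSectorArray ha hb]

/-! ### The Hubbard Hamiltonian as a map of arrays -/

section Hamiltonian

variable (G : SimpleGraph Λ) [DecidableRel G.Adj]

/-- `H` maps each sector into itself (Lieb: `H` is block diagonal in `(N↑, N↓)`).
Lieb, PRL 62 (1989) 1201, Remark (2)(i). [cite: LiebPRL1989, Remark (2)] -/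
theorem IsInSector.hamiltonian_mulVec (t U : ℝ) {ψ : Fock (Orb Λ)} (hψ : IsInSector a b ψ) :
    IsInSector a b (hamiltonian G t U *ᵥ ψ) :=
  (preservesSectors_hamiltonian G t U).isInSector_mulVec hψ

/-- **Lieb's eq. (4) entrywise on a sector**: for `ψ` in the sector `(a, b)`,
`W(Hψ)(sa i, sb j) = Σ_{i'} K(sa i, sa i') W_{i'j} + Σ_{j'} K(sb j, sb j') W_{ij'} + U |sa i ∩ sb j| W_{ij}`,
`K = hoppingMatrix G t`, `W_{ij} = W(ψ)(sa i, sb j)`. Lieb, PRL 62 (1989) 1201, eq. (4).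
[cite: LiebPRL1989, eq. (4)] -/
theorem coeffMatrix_hamiltonian_mulVec_enum (ha : IsSubsetEnum a sa) (hb : IsSubsetEnum b sb)
    (t U : ℝ) {ψ : Fock (Orb Λ)} (hψ : IsInSector a b ψ) (i : Fin p) (j : Fin q) :
    coeffMatrix (hamiltonian G t U *ᵥ ψ) (sa i) (sb j) =
      (∑ i' : Fin p, hoppingMatrix G t (sa i) (sa i') * coeffMatrix ψ (sa i') (sb j)) +
        (∑ j' : Fin q, hoppingMatrix G t (sb j) (sb j') * coeffMatrix ψ (sa i) (sb j')) +
        (U : ℂ) * ((sa i ∩ sb j).card : ℂ) * coeffMatrix ψ (sa i) (sb j) := by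
  have hψ' := (isInSector_iff_coeffMatrix a b ψ).1 hψ
  rw [coeffMatrix_hamiltonian_mulVec]
  set W := coeffMatrix ψ with hW
  have h1 : (hoppingMatrix G t * W) (sa i) (sb j) =
      ∑ i' : Fin p, hoppingMatrix G t (sa i) (sa i') * W (sa i') (sb j) := by
    rw [Matrix.mul_apply]
    exact ha.sum_eq _ fun α hα => by rw [hψ' α (sb j) (fun h => hα h.1), mul_zero]
  have h2 : (W * hoppingMatrix G t) (sa i) (sb j) =
      ∑ j' : Fin q, hoppingMatrix G t (sb j) (sb j') * W (sa i) (sb j') := by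
    rw [Matrix.mul_apply, hb.sum_eq _ fun β hβ => by rw [hψ' (sa i) β (fun h => hβ h.2), zero_mul]]
    exact Finset.sum_congr rfl fun j' _ => by rw [hoppingMatrix_transpose_apply, mul_comm]
  have h3 : ((U : ℂ) • ∑ x : Λ, numberAt x * W * numberAt x) (sa i) (sb j) =
      (U : ℂ) * ((sa i ∩ sb j).card : ℂ) * W (sa i) (sb j) := by
    rw [Matrix.smul_apply, Matrix.sum_apply, smul_eq_mul, mul_assoc, ← sum_ite_mem_mul_ite_mem]
    congr 1
    refine Finset.sum_congr rfl fun x _ => ?_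
    rw [numberAt_eq_diagonal, Matrix.mul_diagonal, Matrix.diagonal_mul]
  rw [Matrix.add_apply, Matrix.add_apply, h1, h2, h3]

/-- **The Hubbard Hamiltonian as a map of coordinate arrays**: for integer tables `Ka`, `Kb`, `d`
matching the hopping entries between the enumerated subsets and the double occupancies,
`H (ofSectorArray w) = ofSectorArray (i j ↦ Σ_{i'} Ka i i' w_{i'j} + Σ_{j'} Kb j j' w_{ij'} + U d i j w_{ij})`.
Lieb, PRL 62 (1989) 1201, eq. (4). [cite: LiebPRL1989, eq. (4)] -/
theorem hamiltonian_mulVec_ofSectorArray (ha : IsSubsetEnum a sa) (hb : IsSubsetEnum b sb) (t U : ℝ)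
    {Ka : Fin p → Fin p → ℤ} {Kb : Fin q → Fin q → ℤ} {d : Fin p → Fin q → ℕ}
    (hKa : ∀ i i', hoppingMatrix G t (sa i) (sa i') = (Ka i i' : ℂ))
    (hKb : ∀ j j', hoppingMatrix G t (sb j) (sb j') = (Kb j j' : ℂ))
    (hd : ∀ i j, (sa i ∩ sb j).card = d i j) (w : Fin p → Fin q → ℂ) :
    hamiltonian G t U *ᵥ ofSectorArray sa sb w =
      ofSectorArray sa sb (fun i j => (∑ i', (Ka i i' : ℂ) * w i' j) + (∑ j', (Kb j j' : ℂ) * w i j') +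
        (U : ℂ) * (d i j : ℂ) * w i j) := by
  have hψ := isInSector_ofSectorArray ha hb w
  refine IsInSector.eq_of_coeffMatrix_eq ha hb (IsInSector.hamiltonian_mulVec G t U hψ)
    (isInSector_ofSectorArray ha hb _) fun i j => ?_
  rw [coeffMatrix_hamiltonian_mulVec_enum G ha hb t U hψ, coeffMatrix_ofSectorArray ha hb]
  simp only [coeffMatrix_ofSectorArray ha hb, hKa, hKb, hd]

end Hamiltonian

/-! ### The elementary fermion operators as maps of arrays -/

section Fermion

variable {p' q' : ℕ} {sa' : Fin p' → Finset Λ} {sb' : Fin q' → Finset Λ}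

omit [Fintype Λ] in
/-- The creation entry is the transposed annihilation entry: `(c†_x)_{s u} = (c_x)_{u s}` (both real).
[folklore] -/
theorem creation_apply_eq_annInt (x : Λ) (s u : Finset Λ) : creation x s u = (annInt x u s : ℂ) := by
  rw [creation_apply, ← annihilation_apply, annihilation_eq_cast]

/-- **`c_{x↑}` on arrays**: from the sector `(a+1, b)` (enumeration `sa'` of the `(a+1)`-subsets) to
the sector `(a, b)`: `c_{x↑} (ofSectorArray sa' sb w) = ofSectorArray sa sb (i j ↦ Σ_{i'} (c_x)_{sa i, sa' i'} w_{i'j})`.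
Lieb, PRL 62 (1989) 1201, proof of Theorem 1; Tasaki (2020) §9.2.1. [cite: LiebPRL1989, proof of Theorem 1] -/
theorem annihilation_up_mulVec_ofSectorArray (ha' : IsSubsetEnum (a + 1) sa') (ha : IsSubsetEnum a sa)
    (hb : IsSubsetEnum b sb) (x : Λ) (w : Fin p' → Fin q → ℂ) :
    annihilation (orb x 0) *ᵥ ofSectorArray sa' sb w =
      ofSectorArray sa sb (fun i j => ∑ i', (annInt x (sa i) (sa' i') : ℂ) * w i' j) := by
  have hψ := isInSector_ofSectorArray ha' hb w
  have hψ' := (isInSector_iff_coeffMatrix (a + 1) b _).1 hψ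
  refine IsInSector.eq_of_coeffMatrix_eq ha hb (hψ.annihilation_up_mulVec x)
    (isInSector_ofSectorArray ha hb _) fun i j => ?_
  rw [coeffMatrix_annihilation_up_mulVec, coeffMatrix_ofSectorArray ha hb, Matrix.mul_apply,
    ha'.sum_eq _ fun α hα => by rw [hψ' α (sb j) (fun h => hα h.1), mul_zero]]
  refine Finset.sum_congr rfl fun i' _ => ?_
  rw [annihilation_eq_cast, coeffMatrix_ofSectorArray ha' hb]

/-- **`c†_{x↑}` on arrays**: from the sector `(a, b)` to the sector `(a+1, b)` (enumeration `sa'`):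
`c†_{x↑} (ofSectorArray sa sb w) = ofSectorArray sa' sb (i j ↦ Σ_{i'} (c_x)_{sa i', sa' i} w_{i'j})`.
Lieb, PRL 62 (1989) 1201, proof of Theorem 1. [cite: LiebPRL1989, proof of Theorem 1] -/
theorem creation_up_mulVec_ofSectorArray (ha : IsSubsetEnum a sa) (ha' : IsSubsetEnum (a + 1) sa')
    (hb : IsSubsetEnum b sb) (x : Λ) (w : Fin p → Fin q → ℂ) :
    creation (orb x 0) *ᵥ ofSectorArray sa sb w =
      ofSectorArray sa' sb (fun i j => ∑ i', (annInt x (sa i') (sa' i) : ℂ) * w i' j) := by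
  have hψ := isInSector_ofSectorArray ha hb w
  have hψ' := (isInSector_iff_coeffMatrix a b _).1 hψ
  refine IsInSector.eq_of_coeffMatrix_eq ha' hb (hψ.creation_up_mulVec x)
    (isInSector_ofSectorArray ha' hb _) fun i j => ?_
  rw [coeffMatrix_creation_up_mulVec, coeffMatrix_ofSectorArray ha' hb, Matrix.mul_apply,
    ha.sum_eq _ fun α hα => by rw [hψ' α (sb j) (fun h => hα h.1), mul_zero]]
  refine Finset.sum_congr rfl fun i' _ => ?_
  rw [creation_apply_eq_annInt, coeffMatrix_ofSectorArray ha hb]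

/-- The cardinality sign of an enumerated `a`-subset. [folklore] -/
theorem neg_one_pow_card_enum (ha : IsSubsetEnum a sa) (i : Fin p) :
    ((-1 : ℂ) ^ (sa i).card) = (-1) ^ a := by
  rw [ha.card_eq]

/-- **`c_{x↓}` on arrays**: from the sector `(a, b+1)` (enumeration `sb'` of the `(b+1)`-subsets) to
the sector `(a, b)`, with the up-parity sign `(-1)^a` of the Jordan–Wigner string through the up
orbitals: `c_{x↓} (ofSectorArray sa sb' w) = ofSectorArray sa sb (i j ↦ (-1)^a Σ_{j'} (c_x)_{sb j, sb' j'} w_{ij'})`.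
Tasaki (2020) §9.2.1. [cite: Tasaki2020, §9.2.1] -/
theorem annihilation_down_mulVec_ofSectorArray (ha : IsSubsetEnum a sa) (hb' : IsSubsetEnum (b + 1) sb')
    (hb : IsSubsetEnum b sb) (x : Λ) (w : Fin p → Fin q' → ℂ) :
    annihilation (orb x 1) *ᵥ ofSectorArray sa sb' w =
      ofSectorArray sa sb (fun i j => (-1 : ℂ) ^ a * ∑ j', (annInt x (sb j) (sb' j') : ℂ) * w i j') := by
  have hψ := isInSector_ofSectorArray ha hb' w
  have hψ' := (isInSector_iff_coeffMatrix a (b + 1) _).1 hψ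
  refine IsInSector.eq_of_coeffMatrix_eq ha hb (hψ.annihilation_down_mulVec x)
    (isInSector_ofSectorArray ha hb _) fun i j => ?_
  rw [coeffMatrix_annihilation_down_mulVec, coeffMatrix_ofSectorArray ha hb, Matrix.mul_apply,
    hb'.sum_eq _ fun β hβ => by
      rw [upParity_mul_apply, hψ' (sa i) β (fun h => hβ h.2), mul_zero, zero_mul],
    ← neg_one_pow_card_enum ha i, Finset.mul_sum]
  refine Finset.sum_congr rfl fun j' _ => ?_
  rw [upParity_mul_apply, transpose_apply, annihilation_eq_cast, coeffMatrix_ofSectorArray ha hb']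
  ring

/-- **`c†_{x↓}` on arrays**: from the sector `(a, b)` to the sector `(a, b+1)` (enumeration `sb'`):
`c†_{x↓} (ofSectorArray sa sb w) = ofSectorArray sa sb' (i j ↦ (-1)^a Σ_{j'} (c_x)_{sb j', sb' j} w_{ij'})`.
Tasaki (2020) §9.2.1. [cite: Tasaki2020, §9.2.1] -/
theorem creation_down_mulVec_ofSectorArray (ha : IsSubsetEnum a sa) (hb : IsSubsetEnum b sb)
    (hb' : IsSubsetEnum (b + 1) sb') (x : Λ) (w : Fin p → Fin q → ℂ) :
    creation (orb x 1) *ᵥ ofSectorArray sa sb w =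
      ofSectorArray sa sb' (fun i j => (-1 : ℂ) ^ a * ∑ j', (annInt x (sb j') (sb' j) : ℂ) * w i j') := by
  have hψ := isInSector_ofSectorArray ha hb w
  have hψ' := (isInSector_iff_coeffMatrix a b _).1 hψ
  refine IsInSector.eq_of_coeffMatrix_eq ha hb' (hψ.creation_down_mulVec x)
    (isInSector_ofSectorArray ha hb' _) fun i j => ?_
  rw [coeffMatrix_creation_down_mulVec, coeffMatrix_ofSectorArray ha hb', Matrix.mul_apply,
    hb.sum_eq _ fun β hβ => by
      rw [upParity_mul_apply, hψ' (sa i) β (fun h => hβ h.2), mul_zero, zero_mul],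
    ← neg_one_pow_card_enum ha i, Finset.mul_sum]
  refine Finset.sum_congr rfl fun j' _ => ?_
  rw [upParity_mul_apply, transpose_apply, creation_apply_eq_annInt, coeffMatrix_ofSectorArray ha hb]
  ring

end Fermion

end TwoSpecies

end Literature.MathematicalPhysics.QuantumLattice
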